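import Mathlib
import HarnessLib
import Summits.ResolutionOfSingularities.ResolutionOfSingularities.Theorems.HomologicalConductorPersistenceRecurrenceTraceCeiling
import Summits.ResolutionOfSingularities.ResolutionOfSingularities.Theorems.HomologicalConductorPersistenceConductorCeiling

/-!
# Ω-recurrence certificates at a non-normal stage: a RECURRENT conductor bounds `ca(R)` at ALL levels,
# `ca(R) ⊆ 𝔠`

Route `ResolutionOfSingularities/HomologicalConductor`, chain W4.4b, rung S-2 `PersistenceSurface`
(stmt-ResolutionOfSingularities-19970), stub C3′ (Σ8: non-normal stages); seat res-L1-w44b-stub-2 (gen 5), row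
«Ω-recurrence certificates — kernel shape», answering item (iii) «level bookkeeping: when is `𝔠 = Hom_B(C,B)` a
3rd/4th syzygy» of res-L1-w44b-lead-1's S2-LEAD-g3 §4 in RECURRENCE form.  [OURS · L1 w44b; AI-written, weaker
than expert review; NOT a statement of the manuscript under study (Hironaka 2017), and no statement of that
manuscript is used.]

The tree's CONDUCTOR CEILING (`…PersistenceConductorCeiling`, lead-1 p550697) is `ca³(R) ⊆ 𝔠` for a
module-finite intermediate ring `R ⊆ C ⊆ Frac R` (the conductor `𝔠 ≅ Hom_R(C,R)` is a second syzygy), and its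
level-free form `cohomologyAnnihilator_le_conductor_of_forall_isSyzygy` asks for `𝔠` to be an `s`-th syzygy
for ALL large `s`.  With `…PersistenceRecurrenceTraceCeiling` (p555144) that hypothesis is replaced by ONE
Ω-recurrence certificate:

* **`cohomologyAnnihilator_le_conductor_of_retract_isSyzygy`** — if `𝔠` (as an `R`-module) is a retract of a
  `p`-th syzygy module of itself for some `p ≥ 1` (e.g. `R` a hypersurface / Gorenstein stage where the maximal
  Cohen–Macaulay module `𝔠` is periodic up to free summands), then `ca(R) ⊆ 𝔠` — every level;
  `cohomologyAnnihilator_le_conductor_of_isSyzygy_self` — the periodic case `IsSyzygy p 𝔠 𝔠`;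
* `cohomologyAnnihilator_le_conductor_of_recurrent` — the same when `𝔠` belongs (as a module) to any recurrent
  class `𝒞` (every member finitely generated and a retract of a first syzygy module of a member).

Proof: `ca(R) ⊆ 𝔠·𝔠⁻¹` (recurrent rank-one ceiling) and `𝔠·𝔠⁻¹ ⊆ 𝔠` (`coe_mul_inv_le_coe`: the trace ideal of
the conductor is the conductor).

References (mechanism only): S. B. Iyengar, R. Takahashi, IMRN 2016, arXiv:1404.1476, §2
[`IyengarTakahashi2014`].
-/

noncomputable section

-- single-problem summit: the doubled namespace component `ResolutionOfSingularities` is forced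
set_option linter.dupNamespace false

namespace Summit.ResolutionOfSingularities.ResolutionOfSingularities.Theorems.HomologicalConductor.RecurrenceConductorCeiling

open CategoryTheory CategoryTheory.Abelian Literature.RingTheory.CohomologyAnnihilator
open scoped nonZeroDivisors
open Summit.ResolutionOfSingularities.ResolutionOfSingularities.Theorems.NoZeno.SandwichCluster
open Summit.ResolutionOfSingularities.ResolutionOfSingularities.Theorems.HomologicalConductor.RecurrenceTraceCeiling
open Summit.ResolutionOfSingularities.ResolutionOfSingularities.Theorems.HomologicalConductor.PersistenceConductorCeiling

universe u

variable {R : Type u} [CommRing R] [IsDomain R] [IsNoetherianRing R] {K : Type u} [Field K] [Algebra R K]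
  [IsFractionRing R K]

omit [IsNoetherianRing R] in
/-- From the trace ideal to the conductor: `x ∈ 𝔠·𝔠⁻¹ ⇒ x ∈ 𝔠` (pull back `coe_mul_inv_le_coe`).
[folklore] -/
theorem mem_conductor_of_algebraMap_mem_mul_inv (M : Submodule R K) (hMmul : ∀ a ∈ M, ∀ b ∈ M, a * b ∈ M)
    (𝔠 : Ideal R) (h𝔠 : ∀ r : R, r ∈ 𝔠 ↔ ∀ m ∈ M, ∃ r' : R, algebraMap R K r' = algebraMap R K r * m)
    {x : R} (hx : algebraMap R K x ∈ (𝔠 : FractionalIdeal R⁰ K) * (𝔠 : FractionalIdeal R⁰ K)⁻¹) :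
    x ∈ 𝔠 := by
  have hmem' := coe_mul_inv_le_coe M hMmul 𝔠 h𝔠 hx
  obtain ⟨r, hr, hrx⟩ := (FractionalIdeal.mem_coeIdeal R⁰).mp hmem'
  rwa [← IsFractionRing.injective R K hrx]

/-- **THE RECURRENT CONDUCTOR CEILING `ca(R) ⊆ 𝔠`.** `R` a noetherian domain with fraction field `K`,
`M ⊆ K` a finitely generated `R`-submodule closed under multiplication (the module-finite overring `C`),
`𝔠 = {r | rM ⊆ R}` its conductor; if `𝔠` (as an `R`-module) is a retract of a `p`-th syzygy module of itself
for some `p ≥ 1`, then every element of the cohomology annihilator `ca(R) = ⋃ₛ caˢ(R)` lies in `𝔠`. [folklore] -/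
theorem cohomologyAnnihilator_le_conductor_of_retract_isSyzygy (M : Submodule R K)
    (hMmul : ∀ a ∈ M, ∀ b ∈ M, a * b ∈ M) (hMfg : M.FG) (𝔠 : Ideal R)
    (h𝔠 : ∀ r : R, r ∈ 𝔠 ↔ ∀ m ∈ M, ∃ r' : R, algebraMap R K r' = algebraMap R K r * m)
    {p : ℕ} (hp : 0 < p) {N : ModuleCat.{u} R} (hN : IsSyzygy p (ModuleCat.of R ↥𝔠) N)
    (i : ModuleCat.of R ↥𝔠 ⟶ N) (r : N ⟶ ModuleCat.of R ↥𝔠) (hir : i ≫ r = 𝟙 _) :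
    cohomologyAnnihilator R ≤ 𝔠 := fun _ hx =>
  mem_conductor_of_algebraMap_mem_mul_inv M hMmul 𝔠 h𝔠
    (algebraMap_mem_mul_inv_of_mem_cohomologyAnnihilator_of_retract_isSyzygy K 𝔠
      (conductor_ne_bot M hMfg 𝔠 h𝔠) hp hN i r hir hx)

/-- The periodic case: `𝔠` is a `p`-th syzygy module of itself (`p ≥ 1`) ⇒ `ca(R) ⊆ 𝔠`. [folklore] -/
theorem cohomologyAnnihilator_le_conductor_of_isSyzygy_self (M : Submodule R K)
    (hMmul : ∀ a ∈ M, ∀ b ∈ M, a * b ∈ M) (hMfg : M.FG) (𝔠 : Ideal R)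
    (h𝔠 : ∀ r : R, r ∈ 𝔠 ↔ ∀ m ∈ M, ∃ r' : R, algebraMap R K r' = algebraMap R K r * m)
    {p : ℕ} (hp : 0 < p) (h𝔠𝔠 : IsSyzygy p (ModuleCat.of R ↥𝔠) (ModuleCat.of R ↥𝔠)) :
    cohomologyAnnihilator R ≤ 𝔠 :=
  cohomologyAnnihilator_le_conductor_of_retract_isSyzygy M hMmul hMfg 𝔠 h𝔠 hp h𝔠𝔠 (𝟙 _) (𝟙 _)
    (Category.comp_id _)

/-- **Class form**: if `𝔠` belongs (as a module) to a recurrent class `𝒞`, then `ca(R) ⊆ 𝔠`. [folklore] -/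
theorem cohomologyAnnihilator_le_conductor_of_recurrent (𝒞 : ModuleCat.{u} R → Prop)
    (hfin : ∀ X, 𝒞 X → Module.Finite R X)
    (hrec : ∀ X, 𝒞 X → ∃ (Y N : ModuleCat.{u} R) (i : X ⟶ N) (r : N ⟶ X),
      𝒞 Y ∧ IsSyzygy 1 Y N ∧ i ≫ r = 𝟙 X)
    (M : Submodule R K) (hMmul : ∀ a ∈ M, ∀ b ∈ M, a * b ∈ M) (hMfg : M.FG) (𝔠 : Ideal R)
    (h𝔠 : ∀ r : R, r ∈ 𝔠 ↔ ∀ m ∈ M, ∃ r' : R, algebraMap R K r' = algebraMap R K r * m)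
    (h𝔠𝒞 : 𝒞 (ModuleCat.of R ↥𝔠)) : cohomologyAnnihilator R ≤ 𝔠 := fun _ hx =>
  mem_conductor_of_algebraMap_mem_mul_inv M hMmul 𝔠 h𝔠
    (algebraMap_mem_mul_inv_of_mem_cohomologyAnnihilator_of_recurrent K 𝒞 hfin hrec 𝔠
      (conductor_ne_bot M hMfg 𝔠 h𝔠) h𝔠𝒞 hx)

/-- Level by level: under the recurrence of `𝔠`, `caᵐ(R) ⊆ 𝔠` for EVERY `m` (the tree's p550697 is `m = 3`
without recurrence). [folklore] -/
theorem cohomologyAnnihilatorOfDegree_le_conductor_of_retract_isSyzygy (M : Submodule R K)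
    (hMmul : ∀ a ∈ M, ∀ b ∈ M, a * b ∈ M) (hMfg : M.FG) (𝔠 : Ideal R)
    (h𝔠 : ∀ r : R, r ∈ 𝔠 ↔ ∀ m ∈ M, ∃ r' : R, algebraMap R K r' = algebraMap R K r * m)
    {p : ℕ} (hp : 0 < p) {N : ModuleCat.{u} R} (hN : IsSyzygy p (ModuleCat.of R ↥𝔠) N)
    (i : ModuleCat.of R ↥𝔠 ⟶ N) (r : N ⟶ ModuleCat.of R ↥𝔠) (hir : i ≫ r = 𝟙 _) (m : ℕ) :
    cohomologyAnnihilatorOfDegree R m ≤ 𝔠 :=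
  (cohomologyAnnihilatorOfDegree_le m).trans
    (cohomologyAnnihilator_le_conductor_of_retract_isSyzygy M hMmul hMfg 𝔠 h𝔠 hp hN i r hir)

end Summit.ResolutionOfSingularities.ResolutionOfSingularities.Theorems.HomologicalConductor.RecurrenceConductorCeiling

end
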